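import Literature.AlgebraicGeometry.Motives.HodgeStructureSymmetricIdempotents
import Literature.AlgebraicGeometry.Motives.HodgeStructureEndAlgTwoSidedIdeals
import HarnessLib

/-!
# THE ROSATI INVOLUTION FIXES EVERY CENTRAL IDEMPOTENT OF `E_φ`: a central idempotent of the endomorphism algebra of a polarized
# `ℚ`-Hodge structure is the `ψ`-orthogonal projector onto its image, hence `†`-symmetric; its kernel is the `ψ`-orthogonal of its
# image (isotypic components are mutually `ψ`-orthogonal); every two-sided ideal of `E_φ` is `†`-stable
# (Milne 1999 §1: «Every Rosati involution `†` preserves each factor of `C₀(A)`»; Lange 2023 Thm. 2.4.19, §2.4.4)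

[topic AlgebraicGeometry/Motives]

Layer `Literature/AlgebraicGeometry/Motives`, lane `lit-hodgefound` (Track 2 foundations library; prover seat
`lit-hodgefound-p02`, generation 50, self-proposed row g50-#6). THEOREMS ONLY: no definition, no named fact (net debt `0`),
no instance, no notation.  Joins, BY NAME, g50-#5 `Motives/HodgeStructureSymmetricIdempotents` (the `ψ`-orthogonal projector
`P_S = S.toSubmodule.projection (ψ.form.orthogonal S.toSubmodule) (ψ.isCompl_orthogonal S)` onto a sub-Hodge structure:
`P_S ∈ E_φ`, `P_S† = P_S`, `Im P_S = S`) and g50-#3 `Motives/HodgeStructureEndAlgTwoSidedIdeals`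
(`exists_central_idempotent_generator_of_isPolarizable`: every two-sided ideal of `E_φ` is `E_φ z` for a central idempotent `z`).

## The sources, verbatim

J. S. Milne, *Lefschetz classes on abelian varieties*, Duke Math. J. 96 (1999) [Milne1999LefschetzClasses], §1 (p. 644, held
`paper:doi-10-1215-s0012-7094-99-09620-5` folio 7): "let `C₀(A)` be the centre of the `ℚ`-algebra `End⁰(A)` — it is a product of
fields, each of which is either a CM-field or `ℚ`. Every Rosati involution `†` preserves each factor of `C₀(A)` and acts on it
as complex conjugation."  The factors of the centre are the `C₀(A) εₖ` for the primitive central idempotents `εₖ`; "`†` preserves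
each factor" is `εₖ† = εₖ`, equivalently `z† = z` for EVERY central idempotent `z = Σ_{k ∈ J} εₖ`, equivalently every two-sided
ideal `E_φ z` is `†`-stable.  (The second half, "acts as complex conjugation", is the positivity of `†` on the centre — the tree's
`Motives/HodgeStructureCentreAdjointTotallyReal`, `…CMOddWeightCentreSkewUnit`; not restated.)

H. Lange, *Abelian Varieties over the Complex Numbers* [Lange2023AbelianVarietiesComplex], §2.4.3 Thm. 2.4.19 (p. 121: abelian
subvarieties ↔ symmetric idempotents `ε_Y`) and §2.4.4 (pp. 122–124: complementary pairs, `N_Y N_Z = 0`, the isotypic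
decomposition `X → X₁^{n₁} × ⋯ × X_r^{n_r}` of Thm. 2.4.25 and `End_ℚ(X) ≅ ⊕ M_{nᵢ}(Fᵢ)`, Cor. 2.4.26).

THE MECHANISM (Hodge structures; shorter than the printed route through norm-endomorphisms): let `z ∈ E_φ` be a central idempotent
and `P = P_{Im z} ∈ E_φ` the `ψ`-orthogonal projector onto the sub-Hodge structure `Im z` (g50-#5).  Two idempotents with the same
image absorb each other: `z P = P`, `P z = z`; and `P z = z P` because `z` is central.  Hence `z = P z = z P = P`, so `z† = P† = P = z`
and `Ker z = Ker P = (Im z)^{⊥ψ}`.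

## What is proved (namespace `Literature.AlgebraicGeometry.Motives.HodgeStructure`; `ψ : Polarization H`, `V` finite-dimensional)

* §1 `eq_of_isIdempotentElem_of_range_eq_of_commute` (commuting idempotents with the same image are equal).
* §2 **`Polarization.eq_projection_orthogonal_of_central`** (a central idempotent `z ∈ E_φ` IS the orthogonal projector onto
  `Im z`), **`Polarization.adjoint_eq_self_of_central`** (`z† = z`), `Polarization.adjoint_coe_eq_self_of_mem_center` (the same for
  `z ∈ Z(E_φ)` as a subalgebra element), **`Polarization.ker_eq_orthogonal_range_of_central`** (`Ker z = (Im z)^{⊥ψ}`),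
  `Polarization.isCompl_range_orthogonal_of_central`.
* §3 ISOTYPIC COMPONENTS ARE `ψ`-ORTHOGONAL: **`Polarization.form_apply_apply_eq_zero_of_central`** (`z` central idempotent, `z w = 0`
  ⟹ `ψ(z v, w') = 0` whenever `w' ∈ Im y` with `z y = 0`; stated as `ψ(z v, y w) = 0` for `z y = 0`),
  `Polarization.range_le_orthogonal_range_of_central` (`Im y ⊆ (Im z)^{⊥ψ}`).
* §4 **TWO-SIDED IDEALS OF `E_φ` ARE `†`-STABLE**: `Polarization.adjoint_mem_center` (`†` preserves the centre),
  **`Polarization.adjoint_mem_twoSidedIdeal`** (`a ∈ I ⟹ a† ∈ I` for every two-sided ideal `I ⊴ E_φ`),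
  `Polarization.adjoint_mem_twoSidedIdeal_iff`.

## References

* [Milne1999LefschetzClasses] J. S. Milne, *Lefschetz classes on abelian varieties*, Duke Math. J. 96 (1999) 639–675: §1 p. 644.
* [Lange2023AbelianVarietiesComplex] H. Lange, *Abelian Varieties over the Complex Numbers*, Springer (2023): §2.4.3 Thm. 2.4.19
  (p. 121), §2.4.4 Lemma 2.4.22, Thm. 2.4.25, Cor. 2.4.26 (pp. 122–124).
* [Huybrechts2016K3] D. Huybrechts, *Lectures on K3 Surfaces*, CUP (2016): §3.3.5 (the adjoint involution), Lemma 3.3.12.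
-/

noncomputable section

open Module

namespace Literature.AlgebraicGeometry.Motives

namespace HodgeStructure

universe u

variable {V : Type u} [AddCommGroup V] [Module ℚ V] [Module.Finite ℚ V] {n : ℤ} {H : HodgeStructure V n}

/-! ## §1 Commuting idempotents with the same image coincide -/

omit [Module.Finite ℚ V] in
/-- Two idempotent endomorphisms with the same image absorb each other (`e P = P`, `P e = e`); if they commute they are equal.
[cite: Lange2023AbelianVarietiesComplex, §2.4.3 Thm. 2.4.19 (p. 121, proof: "`f_ν` is multiplication by `n` on `Im f_ν` implying `f₂ f₁ = n f₁` and `f₁ f₂ = n f₂`")] -/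
theorem eq_of_isIdempotentElem_of_range_eq_of_commute {e P : Module.End ℚ V} (he : IsIdempotentElem e)
    (hP : IsIdempotentElem P) (hr : LinearMap.range e = LinearMap.range P) (hcomm : e * P = P * e) : e = P := by
  have h1 : e * P = P := (LinearMap.IsIdempotentElem.comp_eq_right_iff he P).2 hr.symm.le
  have h2 : P * e = e := (LinearMap.IsIdempotentElem.comp_eq_right_iff hP e).2 hr.le
  rw [← hcomm, h1] at h2
  exact h2.symm

/-! ## §2 A central idempotent of `E_φ` is the orthogonal projector onto its image: `z† = z`, `Ker z = (Im z)^⊥` -/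

/-- **A central idempotent `z ∈ E_φ` is the `ψ`-orthogonal projector onto the sub-Hodge structure `Im z`** (for every
polarization `ψ`). [cite: Milne1999LefschetzClasses, §1 p. 644] [cite: Lange2023AbelianVarietiesComplex, §2.4.3 Thm. 2.4.19 (p. 121)] -/
theorem Polarization.eq_projection_orthogonal_of_central (ψ : Polarization H) {z : Module.End ℚ V} (hzE : z ∈ H.endAlg)
    (hz : IsIdempotentElem z) (hcomm : ∀ a ∈ H.endAlg, z * a = a * z) :
    z = (endAlg.toHom ⟨z, hzE⟩).range.toSubmodule.projection
          (ψ.form.orthogonal (endAlg.toHom ⟨z, hzE⟩).range.toSubmodule) (ψ.isCompl_orthogonal _) :=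
  eq_of_isIdempotentElem_of_range_eq_of_commute hz (Submodule.isIdempotentElem_projection _)
    (Submodule.range_projection _).symm (hcomm _ (ψ.projection_orthogonal_mem_endAlg _))

/-- **«Every Rosati involution `†` preserves each factor of the centre»: a central idempotent of `E_φ` is `†`-symmetric, `z† = z`.**
[cite: Milne1999LefschetzClasses, §1 p. 644] -/
theorem Polarization.adjoint_eq_self_of_central (ψ : Polarization H) {z : Module.End ℚ V} (hzE : z ∈ H.endAlg)
    (hz : IsIdempotentElem z) (hcomm : ∀ a ∈ H.endAlg, z * a = a * z) : ψ.adjoint z = z := by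
  rw [ψ.eq_projection_orthogonal_of_central hzE hz hcomm]
  exact ψ.adjoint_projection_orthogonal _

/-- The same for an idempotent of the centre `Z(E_φ)` given as a subalgebra element. [cite: Milne1999LefschetzClasses, §1 p. 644] -/
theorem Polarization.adjoint_coe_eq_self_of_mem_center (ψ : Polarization H) {z : H.endAlg}
    (hzc : z ∈ Subalgebra.center ℚ H.endAlg) (hz : IsIdempotentElem z) :
    ψ.adjoint (z : Module.End ℚ V) = z :=
  ψ.adjoint_eq_self_of_central z.2 (congrArg Subtype.val hz.eq)
    fun a ha => congrArg Subtype.val ((Subalgebra.mem_center_iff.1 hzc ⟨a, ha⟩).symm)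

/-- **`Ker z = (Im z)^{⊥ψ}` for a central idempotent `z ∈ E_φ`**: the complementary isotypic block is the ORTHOGONAL complement
(Lemma 2.4.22: `N_Y|_Z = 0` for the complementary abelian subvariety `Z`). [cite: Lange2023AbelianVarietiesComplex, §2.4.4 Lemma 2.4.22 (p. 122)]
[cite: Milne1999LefschetzClasses, §1 p. 644] -/
theorem Polarization.ker_eq_orthogonal_range_of_central (ψ : Polarization H) {z : Module.End ℚ V} (hzE : z ∈ H.endAlg)
    (hz : IsIdempotentElem z) (hcomm : ∀ a ∈ H.endAlg, z * a = a * z) :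
    LinearMap.ker z = ψ.form.orthogonal (LinearMap.range z) :=
  ψ.ker_eq_orthogonal_range (ψ.adjoint_eq_self_of_central hzE hz hcomm)

/-- `V = Im z ⊕ (Im z)^{⊥ψ}` for a central idempotent `z ∈ E_φ`. [cite: Lange2023AbelianVarietiesComplex, §2.4.4 Thm. 2.4.23 (p. 122)] -/
theorem Polarization.isCompl_range_orthogonal_of_central (ψ : Polarization H) {z : Module.End ℚ V} (hzE : z ∈ H.endAlg)
    (hz : IsIdempotentElem z) (hcomm : ∀ a ∈ H.endAlg, z * a = a * z) :
    IsCompl (LinearMap.range z) (ψ.form.orthogonal (LinearMap.range z)) :=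
  ψ.isCompl_range_orthogonal hz (ψ.adjoint_eq_self_of_central hzE hz hcomm)

/-! ## §3 Isotypic components are `ψ`-orthogonal -/

/-- **`ψ(z v, y w) = 0` whenever `z` is a central idempotent of `E_φ` and `z y = 0`** (e.g. `y = 1 - z`, or `y` another central
idempotent orthogonal to `z`): distinct isotypic components of a polarized Hodge structure are `ψ`-orthogonal
(`N_Y N_Z = 0`, Lemma 2.4.22 (3)). [cite: Lange2023AbelianVarietiesComplex, §2.4.4 Lemma 2.4.22 (3) (p. 122)] [cite: Milne1999LefschetzClasses, §1 p. 644] -/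
theorem Polarization.form_apply_apply_eq_zero_of_central (ψ : Polarization H) {z y : Module.End ℚ V} (hzE : z ∈ H.endAlg)
    (hz : IsIdempotentElem z) (hcomm : ∀ a ∈ H.endAlg, z * a = a * z) (hzy : z * y = 0) (v w : V) :
    ψ.form (z v) (y w) = 0 := by
  rw [← ψ.form_apply_adjoint, ψ.adjoint_eq_self_of_central hzE hz hcomm, ← Module.End.mul_apply, hzy,
    LinearMap.zero_apply, map_zero]

/-- `Im y ⊆ (Im z)^{⊥ψ}` for a central idempotent `z ∈ E_φ` and any `y` with `z y = 0`. [cite: Lange2023AbelianVarietiesComplex, §2.4.4 Lemma 2.4.22 (3) (p. 122)] -/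
theorem Polarization.range_le_orthogonal_range_of_central (ψ : Polarization H) {z y : Module.End ℚ V} (hzE : z ∈ H.endAlg)
    (hz : IsIdempotentElem z) (hcomm : ∀ a ∈ H.endAlg, z * a = a * z) (hzy : z * y = 0) :
    LinearMap.range y ≤ ψ.form.orthogonal (LinearMap.range z) := by
  rintro _ ⟨w, rfl⟩
  rw [LinearMap.BilinForm.mem_orthogonal_iff]
  rintro _ ⟨v, rfl⟩
  exact ψ.form_apply_apply_eq_zero_of_central hzE hz hcomm hzy v w

/-! ## §4 The centre and every two-sided ideal of `E_φ` are `†`-stable -/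

/-- `†` preserves the centre of `E_φ`: `z ∈ Z(E_φ) ⟹ z† ∈ Z(E_φ)` (`(b z†) = (z b†)† = (b† z)† = z† b`).
[cite: Milne1999LefschetzClasses, §1 p. 643–644] [cite: Huybrechts2016K3, Lemma 3.3.12] -/
theorem Polarization.adjoint_mem_center (ψ : Polarization H) {z : H.endAlg} (hzc : z ∈ Subalgebra.center ℚ H.endAlg) :
    (⟨ψ.adjoint (z : Module.End ℚ V), ψ.adjoint_mem_endAlg z.2⟩ : H.endAlg) ∈ Subalgebra.center ℚ H.endAlg := by
  rw [Subalgebra.mem_center_iff] at hzc ⊢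
  intro b
  apply Subtype.ext
  change (b : Module.End ℚ V) * ψ.adjoint (z : Module.End ℚ V) = ψ.adjoint (z : Module.End ℚ V) * b
  have hb : ψ.adjoint (ψ.adjoint (b : Module.End ℚ V)) = b := ψ.adjoint_adjoint _
  have key := congrArg Subtype.val (hzc ⟨ψ.adjoint (b : Module.End ℚ V), ψ.adjoint_mem_endAlg b.2⟩)
  change ψ.adjoint (b : Module.End ℚ V) * (z : Module.End ℚ V) = (z : Module.End ℚ V) * ψ.adjoint (b : Module.End ℚ V) at key
  calc (b : Module.End ℚ V) * ψ.adjoint (z : Module.End ℚ V)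
      = ψ.adjoint (ψ.adjoint (b : Module.End ℚ V)) * ψ.adjoint (z : Module.End ℚ V) := by rw [hb]
    _ = ψ.adjoint ((z : Module.End ℚ V) * ψ.adjoint (b : Module.End ℚ V)) := (ψ.adjoint_mul _ _).symm
    _ = ψ.adjoint (ψ.adjoint (b : Module.End ℚ V) * (z : Module.End ℚ V)) := by rw [key]
    _ = ψ.adjoint (z : Module.End ℚ V) * b := by rw [ψ.adjoint_mul, hb]

/-- **Every two-sided ideal of `E_φ` is stable under the Rosati involution: `a ∈ I ⟹ a† ∈ I`** (`I = E_φ z` for a central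
idempotent `z`, and `z† = z`: `a = z a ⟹ a† = a† z = z a†`). [cite: Milne1999LefschetzClasses, §1 p. 644]
[cite: Lange2023AbelianVarietiesComplex, §2.4.4 Cor. 2.4.26 (p. 124)] -/
theorem Polarization.adjoint_mem_twoSidedIdeal (ψ : Polarization H) (I : TwoSidedIdeal H.endAlg) {a : H.endAlg} (ha : a ∈ I) :
    (⟨ψ.adjoint (a : Module.End ℚ V), ψ.adjoint_mem_endAlg a.2⟩ : H.endAlg) ∈ I := by
  obtain ⟨z, -, hz, hzc, hmem⟩ := exists_central_idempotent_generator_of_isPolarizable H ⟨ψ⟩ I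
  have hzadj : ψ.adjoint (z : Module.End ℚ V) = z :=
    ψ.adjoint_eq_self_of_central z.2 (congrArg Subtype.val hz.eq) fun b hb => congrArg Subtype.val (hzc ⟨b, hb⟩)
  have hza : ((z : Module.End ℚ V)) * a = a := congrArg Subtype.val ((hmem a).1 ha)
  refine (hmem _).2 (Subtype.ext ?_)
  change (z : Module.End ℚ V) * ψ.adjoint (a : Module.End ℚ V) = ψ.adjoint (a : Module.End ℚ V)
  -- `a† = (z a)† = a† z† = a† z = z a†`
  have h1 : ψ.adjoint (a : Module.End ℚ V) * z = ψ.adjoint (a : Module.End ℚ V) := by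
    conv_rhs => rw [← hza, ψ.adjoint_mul, hzadj]
  have h2 := congrArg Subtype.val (hzc ⟨ψ.adjoint (a : Module.End ℚ V), ψ.adjoint_mem_endAlg a.2⟩)
  change (z : Module.End ℚ V) * ψ.adjoint (a : Module.End ℚ V) = ψ.adjoint (a : Module.End ℚ V) * z at h2
  rw [h2, h1]

/-- `a† ∈ I ⟺ a ∈ I` for a two-sided ideal `I ⊴ E_φ` (`†` is an involution). [cite: Milne1999LefschetzClasses, §1 p. 644] -/
theorem Polarization.adjoint_mem_twoSidedIdeal_iff (ψ : Polarization H) (I : TwoSidedIdeal H.endAlg) (a : H.endAlg) :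
    (⟨ψ.adjoint (a : Module.End ℚ V), ψ.adjoint_mem_endAlg a.2⟩ : H.endAlg) ∈ I ↔ a ∈ I := by
  refine ⟨fun h => ?_, ψ.adjoint_mem_twoSidedIdeal I⟩
  have h2 := ψ.adjoint_mem_twoSidedIdeal I h
  have : (⟨ψ.adjoint (ψ.adjoint (a : Module.End ℚ V)), ψ.adjoint_mem_endAlg (ψ.adjoint_mem_endAlg a.2)⟩ : H.endAlg) = a :=
    Subtype.ext (ψ.adjoint_adjoint _)
  rwa [this] at h2

end HodgeStructure

end Literature.AlgebraicGeometry.Motives
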